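import Mathlib
import Summits.HodgeConjecture.HodgeConjecture.Theorems.HodgeLocusCensusUnitColumnRankD3
import Literature.Combinatorics.Posets.BooleanOrderRaising

/-!
# HodgeLocus census — THEOREM K-MODEL at `d = 3`, `c′ = 1`, in EVERY level: `rank (×ℓ : B_{k−j−1} → B_{k−j}) = min (C(k,j+1), C(k,j))`
(def-free helper of `stmt-HodgeConjecture-16267`; pub-hlocus, seat ivhs-2 = ENGINE B, gen 50; record `pub-hlocus-ivhs-2/gen50/ENGINEB-g50.md` §2–§4,
THEOREM L; companion of anchors 179 `HodgeLocusCensusUnitColumnRankD3.lean` and 188 `…D3Deficit.lean`, whose index convention and `colR 3` bookkeeping it reuses BY NAME)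

certified instances and evidence bearing on the general Hodge conjecture; no claim.

SETTING.  `B = K[x₁,…,x_k]/(x₁²,…,x_k²)`, `ℓ = x₁ + ⋯ + x_k`, `K` a field of characteristic `0`.  THEOREM L of the record — the rank of `×q^{c}` on
`K[y₁,…,y_k]/(y_i^{d−1})`, `q = Σ y_i^{d−2}`, in EVERY degree: `Σ_{s,i} C(k,s)·N_d(j − i(d−2), s)·min (C(k−s,i), C(k−s,i+c))` by the spectator/active block
decomposition — reads at `d = 3` (no spectators) `rank (×ℓ^{c} : B_i → B_{i+c}) = min (C(k,i), C(k,i+c))`.  This file certifies `c = 1` in EVERY level, in the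
index convention of anchors 172/174/179: `B_{k−j}` is indexed by the two-level exponent functions `v : Fin k → Fin 2` with `Σ v_i + j = k·1` (zero set of
size `j`, `card_level`: `dim B_{k−j} = C(k,j)`), and the matrix of `×ℓ : B_{k−j−1} → B_{k−j}` has entry `[List.ofFn v ∈ colR 3 (List.ofFn m)]` (rows = target
monomials, columns = source monomials; `colR 3`, gen 31).  Anchor 179's THEOREM (i) `rank_mulL_modelC1_d3` is the level `j = 2`, `k ≥ 5` (there sharper: `2, 3`
units instead of characteristic `0`); the census cells use single levels, the record's all-degree ladder (PROPOSITION Σ⁗ (iii), `structSc.py`) uses every level.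

THEOREMS (kernel `Matrix.rank` statements).
* `rank_mulL_d3_onto`  — `2j < k`:      rank `=` number of rows    (`= C(k,j)`;   `×ℓ` maps `B_{k−j−1}` ONTO `B_{k−j}`);
* `rank_mulL_d3_into`  — `k < 2(j+1)`:  rank `=` number of columns (`= C(k,j+1)`; `×ℓ` is ONE-TO-ONE on `B_{k−j−1}`);
* `rank_mulL_d3`       — every `k, j`:  rank `= min (C(k,j)) (C(k,j+1))`.

METHOD (THEOREM L's step (e) at `c = 1`, imported BY NAME from `Literature/Combinatorics/Posets/BooleanOrderRaising.lean` = Stanley, *Algebraic Combinatorics*,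
Thm 4.7).  Along the zero-set bijection `v ↦ {l : v l = 0}` (anchor 179's `card_level`, `eq_ind_filter`, `sum_ind`, `card_filter_eq`, `mem_colR_ind_iff`) the matrix
becomes the INCLUSION matrix of `j`-subsets versus `(j+1)`-subsets of `Fin k` (`rank_mulL_d3_eq_rank_incl`, `Matrix.rank_reindex`), whose `mulVec` is Stanley's
LOWERING operator `D` on coefficient functions extended by zero (`mulVec_incl_eq_downOp`).  `D_{j+1}` is one-to-one for `2(j+1) > k` (`downOp_eq_zero_imp`) and onto
`K(B_k)_j` for `2j < k` (`upOp_surjOn_rank` transported along complementation, `downOp_comp_compl`); the rank is the `finrank` of the range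
(`LinearMap.finrank_range_of_inj`, `LinearMap.range_eq_top`); the `min` form needs no binomial inequality: a rank is at most the number of rows and
at most the number of columns (`Matrix.rank_le_card_height`, `Matrix.rank_le_card_width`).  Sorry-free; no definitions.  SCOPE (said plainly): statements
about explicit matrices read off gen 31's `colR`; that these ranks are the `ρ` / the all-degree kernels of THEOREM K⁼ / PROPOSITION Σ⁗ is the record's step
(outside Lean, as in the anchors); characteristic `0` is used only through the Literature theorems (anchor 188 records the characteristic-`2` deficits of
the same matrices).  Evidence-class statement; no census number changes; nothing about HC.
-/

set_option linter.dupNamespace false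
set_option autoImplicit false

namespace Summit.HodgeConjecture.HodgeConjecture.HodgeLocus.Census.UnitColumnRankD3Levels

open Module
open Summit.HodgeConjecture.HodgeConjecture.HodgeLocus.Census.ModelNonJumpC1All (colR)
open Summit.HodgeConjecture.HodgeConjecture.HodgeLocus.Census.UnitColumnRankD3 (eq_ind_filter card_filter_eq sum_ind card_level mem_colR_ind_iff)
open Literature.Combinatorics.Posets.BooleanOrderRaising (upOp downOp downOp_apply downOp_rank downOp_eq_zero_imp upOp_surjOn_rank downOp_comp_compl)

/-! ## Indicator bookkeeping -/

/-- the two-level indicator `𝟙_S = (l ↦ if l ∈ S then 0 else 1)` determines `S` -/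
theorem ind_inj {k : ℕ} {S T : Finset (Fin k)}
    (h : (fun l => if l ∈ S then (0 : Fin 2) else 1) = fun l => if l ∈ T then (0 : Fin 2) else 1) : S = T := by
  ext l
  have hl := congrFun h l
  by_cases hS : l ∈ S <;> by_cases hT : l ∈ T <;> simp_all

/-- the matrix entry between two indicators: `x^{𝟙_T}` occurs in `ℓ·x^{𝟙_S}` iff `T = S ∖ i` for some `i ∈ S` (anchor 179's `mem_colR_ind_iff`) -/
theorem colR_ind_iff {k : ℕ} (S T : Finset (Fin k)) :
    (List.ofFn fun l => ((if l ∈ T then (0 : Fin 2) else 1 : Fin 2) : ℕ)) ∈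
        colR 3 (List.ofFn fun l => ((if l ∈ S then (0 : Fin 2) else 1 : Fin 2) : ℕ)) ↔ ∃ i ∈ S, T = S.erase i := by
  rw [mem_colR_ind_iff]
  refine exists_congr fun i => and_congr_right fun _ => ⟨fun h => ?_, fun h => by rw [h]⟩
  have h1 := List.ofFn_inj.mp h
  exact ind_inj (funext fun l => Fin.ext (congrFun h1 l))

/-! ## The inclusion matrix of `j`-sets versus `(j+1)`-sets acts as Stanley's `D` -/

/-- `(W x)(T) = Σ_{i ∉ T} x(T ∪ i) = (D x̃)(T)`, `x̃` the extension of `x` by zero off the `(j+1)`-sets -/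
theorem mulVec_incl_eq_downOp {K : Type*} [Field K] {k j : ℕ} (x : {S : Finset (Fin k) // S.card = j + 1} → K)
    (T : {S : Finset (Fin k) // S.card = j}) :
    (Matrix.of fun (T : {S : Finset (Fin k) // S.card = j}) (S : {S : Finset (Fin k) // S.card = j + 1}) =>
        if ∃ i ∈ S.1, T.1 = S.1.erase i then (1 : K) else 0).mulVec x T =
      downOp (fun U => if h : U.card = j + 1 then x ⟨U, h⟩ else 0) T.1 := by
  have hcard : ∀ i ∈ T.1ᶜ, (insert i T.1).card = j + 1 := fun i hi => by
    rw [Finset.card_insert_of_notMem (Finset.mem_compl.mp hi), T.2]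
  set I : Finset {S : Finset (Fin k) // S.card = j + 1} :=
    (T.1ᶜ).attach.image (fun i => ⟨insert i.1 T.1, hcard i.1 i.2⟩) with hI
  have hmemI : ∀ S : {S : Finset (Fin k) // S.card = j + 1}, (∃ i ∈ S.1, T.1 = S.1.erase i) ↔ S ∈ I := by
    intro S
    rw [hI, Finset.mem_image]
    constructor
    · rintro ⟨i, hi, hT⟩
      have hiT : i ∉ T.1 := by rw [hT]; exact Finset.notMem_erase i S.1
      refine ⟨⟨i, Finset.mem_compl.mpr hiT⟩, Finset.mem_attach _ _, Subtype.ext ?_⟩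
      show insert i T.1 = S.1
      rw [hT, Finset.insert_erase hi]
    · rintro ⟨⟨i, hi⟩, -, hS⟩
      have hiT : i ∉ T.1 := Finset.mem_compl.mp hi
      have hS1 : S.1 = insert i T.1 := by rw [← hS]
      exact ⟨i, by rw [hS1]; exact Finset.mem_insert_self i T.1, by rw [hS1, Finset.erase_insert hiT]⟩
  have hinj : Set.InjOn (fun i : {i // i ∈ T.1ᶜ} => (⟨insert i.1 T.1, hcard i.1 i.2⟩ : {S : Finset (Fin k) // S.card = j + 1}))
      ↑((T.1ᶜ).attach) := by
    rintro ⟨i, hi⟩ - ⟨i', hi'⟩ - h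
    have h1 : insert i T.1 = insert i' T.1 := congrArg Subtype.val h
    have h2 : i ∈ insert i' T.1 := by rw [← h1]; exact Finset.mem_insert_self i T.1
    rcases Finset.mem_insert.mp h2 with h3 | h3
    · exact Subtype.ext h3
    · exact absurd h3 (Finset.mem_compl.mp hi)
  symm
  calc downOp (fun U => if h : U.card = j + 1 then x ⟨U, h⟩ else 0) T.1
      = ∑ i ∈ T.1ᶜ, (fun U : Finset (Fin k) => if h : U.card = j + 1 then x ⟨U, h⟩ else 0) (insert i T.1) := downOp_apply _ _
    _ = ∑ i ∈ (T.1ᶜ).attach, (fun U : Finset (Fin k) => if h : U.card = j + 1 then x ⟨U, h⟩ else 0) (insert i.1 T.1) :=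
        (Finset.sum_attach (T.1ᶜ) (fun i => (fun U : Finset (Fin k) => if h : U.card = j + 1 then x ⟨U, h⟩ else 0) (insert i T.1))).symm
    _ = ∑ i ∈ (T.1ᶜ).attach, x ⟨insert i.1 T.1, hcard i.1 i.2⟩ :=
        Finset.sum_congr rfl fun i _ => by dsimp only; rw [dif_pos (hcard i.1 i.2)]
    _ = ∑ S ∈ I, x S := by rw [hI, Finset.sum_image hinj]
    _ = ∑ S, (if S ∈ I then x S else 0) := by rw [Finset.sum_ite_mem, Finset.univ_inter]
    _ = (Matrix.of fun (T : {S : Finset (Fin k) // S.card = j}) (S : {S : Finset (Fin k) // S.card = j + 1}) =>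
          if ∃ i ∈ S.1, T.1 = S.1.erase i then (1 : K) else 0).mulVec x T := by
        simp only [Matrix.mulVec, dotProduct, Matrix.of_apply, ite_mul, one_mul, zero_mul]
        exact Finset.sum_congr rfl fun S _ => if_congr (hmemI S).symm rfl rfl

/-- `2j < k`: the inclusion matrix is ONTO (Stanley 4.7 'onto' transported along complementation: `D f̄ = \overline{U f}`) -/
theorem incl_mulVecLin_surjective (K : Type*) [Field K] [CharZero K] {k j : ℕ} (hj : 2 * j < k) :
    Function.Surjective (Matrix.of fun (T : {S : Finset (Fin k) // S.card = j}) (S : {S : Finset (Fin k) // S.card = j + 1}) =>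
        if ∃ i ∈ S.1, T.1 = S.1.erase i then (1 : K) else 0).mulVecLin := by
  intro y
  set g : Finset (Fin k) → K := fun T => if h : T.card = j then y ⟨T, h⟩ else 0 with hg
  have hg' : ∀ S : Finset (Fin k), S.card ≠ (k - j - 1) + 1 → g Sᶜ = 0 := by
    intro S hS
    rw [hg]; dsimp only
    rw [dif_neg]
    intro hc
    apply hS
    have h1 := Finset.card_compl S
    rw [Fintype.card_fin] at h1
    have h2 : S.card ≤ k := by simpa using Finset.card_le_univ S
    omega
  obtain ⟨f', hf', hUf'⟩ := upOp_surjOn_rank (L := K) (α := Fin k) (k - j - 1) (by rw [Fintype.card_fin]; omega) (fun T => g Tᶜ) hg'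
  refine ⟨fun S => f' S.1ᶜ, funext fun T => ?_⟩
  rw [Matrix.mulVecLin_apply, mulVec_incl_eq_downOp]
  show downOp (fun U => if h : U.card = j + 1 then f' Uᶜ else 0) T.1 = y T
  have hF : (fun U : Finset (Fin k) => if h : U.card = j + 1 then f' Uᶜ else 0) = fun U => f' Uᶜ := by
    funext U
    by_cases h : U.card = j + 1
    · rw [dif_pos h]
    · rw [dif_neg h]; symm; apply hf'; intro hc; apply h
      have h1 := Finset.card_compl U
      rw [Fintype.card_fin] at h1
      have h2 : U.card ≤ k := by simpa using Finset.card_le_univ U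
      omega
  rw [hF, downOp_comp_compl f' T.1, hUf']
  show g T.1ᶜᶜ = y T
  rw [compl_compl, hg]; dsimp only
  rw [dif_pos T.2]

/-- `k < 2(j+1)`: the inclusion matrix is ONE-TO-ONE (Stanley 4.7, dual half `downOp_eq_zero_imp`) -/
theorem incl_mulVecLin_injective (K : Type*) [Field K] [CharZero K] {k j : ℕ} (hj : k < 2 * (j + 1)) :
    Function.Injective (Matrix.of fun (T : {S : Finset (Fin k) // S.card = j}) (S : {S : Finset (Fin k) // S.card = j + 1}) =>
        if ∃ i ∈ S.1, T.1 = S.1.erase i then (1 : K) else 0).mulVecLin := by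
  intro x x' hxx'
  have h0 : (Matrix.of fun (T : {S : Finset (Fin k) // S.card = j}) (S : {S : Finset (Fin k) // S.card = j + 1}) =>
        if ∃ i ∈ S.1, T.1 = S.1.erase i then (1 : K) else 0).mulVecLin (x - x') = 0 := by rw [map_sub, hxx', sub_self]
  set F : Finset (Fin k) → K := fun U => if h : U.card = j + 1 then (x - x') ⟨U, h⟩ else 0 with hFdef
  have hF : ∀ S : Finset (Fin k), S.card ≠ j + 1 → F S = 0 := fun S hS => by rw [hFdef]; dsimp only; rw [dif_neg hS]
  have hD : downOp F = 0 := by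
    funext T
    rw [Pi.zero_apply]
    by_cases hT : T.card = j
    · have h1 := congrFun h0 ⟨T, hT⟩
      rw [Matrix.mulVecLin_apply, mulVec_incl_eq_downOp, Pi.zero_apply] at h1
      exact h1
    · exact downOp_rank hF T hT
  have hF0 := downOp_eq_zero_imp hF (by rw [Fintype.card_fin]; omega) hD
  have hsub : x - x' = 0 := by
    funext S
    have h1 := congrFun hF0 S.1
    rw [hFdef] at h1; dsimp only at h1; rw [dif_pos S.2] at h1
    exact h1
  exact sub_eq_zero.mp hsub

/-- rank of the inclusion matrix, `2j < k`: `= C(k,j)` (number of rows) -/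
theorem rank_incl_onto (K : Type*) [Field K] [CharZero K] {k j : ℕ} (hj : 2 * j < k) :
    (Matrix.of fun (T : {S : Finset (Fin k) // S.card = j}) (S : {S : Finset (Fin k) // S.card = j + 1}) =>
        if ∃ i ∈ S.1, T.1 = S.1.erase i then (1 : K) else 0).rank = Fintype.card {S : Finset (Fin k) // S.card = j} := by
  rw [Matrix.rank, LinearMap.range_eq_top.mpr (incl_mulVecLin_surjective K hj), finrank_top, Module.finrank_fintype_fun_eq_card]

/-- rank of the inclusion matrix, `k < 2(j+1)`: `= C(k,j+1)` (number of columns) -/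
theorem rank_incl_into (K : Type*) [Field K] [CharZero K] {k j : ℕ} (hj : k < 2 * (j + 1)) :
    (Matrix.of fun (T : {S : Finset (Fin k) // S.card = j}) (S : {S : Finset (Fin k) // S.card = j + 1}) =>
        if ∃ i ∈ S.1, T.1 = S.1.erase i then (1 : K) else 0).rank = Fintype.card {S : Finset (Fin k) // S.card = j + 1} := by
  rw [Matrix.rank, LinearMap.finrank_range_of_inj (incl_mulVecLin_injective K hj), Module.finrank_fintype_fun_eq_card]

/-! ## Transfer to the census matrices (anchor 179's index convention) -/

/-- along the zero-set bijection the `colR 3` matrix of `×ℓ : B_{k−j−1} → B_{k−j}` IS the inclusion matrix of `j`-sets versus `(j+1)`-sets -/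
theorem rank_mulL_d3_eq_rank_incl (K : Type*) [Field K] (k j : ℕ) :
    (Matrix.of fun (v : {v : Fin k → Fin 2 // (∑ i, (v i : ℕ)) + j = k * 1}) (m : {m : Fin k → Fin 2 // (∑ i, (m i : ℕ)) + (j + 1) = k * 1}) =>
      if List.ofFn (fun i => (v.1 i : ℕ)) ∈ colR 3 (List.ofFn (fun i => (m.1 i : ℕ))) then (1 : K) else 0).rank =
    (Matrix.of fun (T : {S : Finset (Fin k) // S.card = j}) (S : {S : Finset (Fin k) // S.card = j + 1}) =>
        if ∃ i ∈ S.1, T.1 = S.1.erase i then (1 : K) else 0).rank := by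
  let eR : {v : Fin k → Fin 2 // (∑ i, (v i : ℕ)) + j = k * 1} ≃ {S : Finset (Fin k) // S.card = j} :=
    { toFun := fun v => ⟨Finset.univ.filter (fun l => v.1 l = 0), card_filter_eq v.1 v.2⟩
      invFun := fun s => ⟨fun l => if l ∈ s.1 then 0 else 1, by have h := sum_ind s.1; rw [s.2] at h; exact h⟩
      left_inv := fun v => Subtype.ext (eq_ind_filter v.1).symm
      right_inv := fun s => Subtype.ext (by ext l; by_cases hl : l ∈ s.1 <;> simp [hl]) }
  let eC : {m : Fin k → Fin 2 // (∑ i, (m i : ℕ)) + (j + 1) = k * 1} ≃ {S : Finset (Fin k) // S.card = j + 1} :=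
    { toFun := fun v => ⟨Finset.univ.filter (fun l => v.1 l = 0), card_filter_eq v.1 v.2⟩
      invFun := fun s => ⟨fun l => if l ∈ s.1 then 0 else 1, by have h := sum_ind s.1; rw [s.2] at h; exact h⟩
      left_inv := fun v => Subtype.ext (eq_ind_filter v.1).symm
      right_inv := fun s => Subtype.ext (by ext l; by_cases hl : l ∈ s.1 <;> simp [hl]) }
  rw [← Matrix.rank_reindex eR eC]
  congr 1
  ext T S
  rw [Matrix.reindex_apply, Matrix.submatrix_apply, Matrix.of_apply, Matrix.of_apply]
  exact if_congr (colR_ind_iff S.1 T.1) rfl rfl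

/-- **`2j < k`: `×ℓ : B_{k−j−1} → B_{k−j}` is ONTO** — rank `=` number of rows `= C(k,j)` (characteristic `0`). -/
theorem rank_mulL_d3_onto (K : Type*) [Field K] [CharZero K] (k j : ℕ) (hj : 2 * j < k) :
    (Matrix.of fun (v : {v : Fin k → Fin 2 // (∑ i, (v i : ℕ)) + j = k * 1}) (m : {m : Fin k → Fin 2 // (∑ i, (m i : ℕ)) + (j + 1) = k * 1}) =>
      if List.ofFn (fun i => (v.1 i : ℕ)) ∈ colR 3 (List.ofFn (fun i => (m.1 i : ℕ))) then (1 : K) else 0).rank =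
      Fintype.card {v : Fin k → Fin 2 // (∑ i, (v i : ℕ)) + j = k * 1} := by
  rw [rank_mulL_d3_eq_rank_incl, rank_incl_onto K hj, Fintype.card_finset_len, Fintype.card_fin, card_level]

/-- **`k < 2(j+1)`: `×ℓ : B_{k−j−1} → B_{k−j}` is ONE-TO-ONE** — rank `=` number of columns `= C(k,j+1)` (characteristic `0`). -/
theorem rank_mulL_d3_into (K : Type*) [Field K] [CharZero K] (k j : ℕ) (hj : k < 2 * (j + 1)) :
    (Matrix.of fun (v : {v : Fin k → Fin 2 // (∑ i, (v i : ℕ)) + j = k * 1}) (m : {m : Fin k → Fin 2 // (∑ i, (m i : ℕ)) + (j + 1) = k * 1}) =>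
      if List.ofFn (fun i => (v.1 i : ℕ)) ∈ colR 3 (List.ofFn (fun i => (m.1 i : ℕ))) then (1 : K) else 0).rank =
      Fintype.card {m : Fin k → Fin 2 // (∑ i, (m i : ℕ)) + (j + 1) = k * 1} := by
  rw [rank_mulL_d3_eq_rank_incl, rank_incl_into K hj, Fintype.card_finset_len, Fintype.card_fin, card_level]

/-- **THEOREM L at `d = 3`, `c′ = 1`, every level: `rank (×ℓ : B_{k−j−1} → B_{k−j}) = min (C(k,j), C(k,j+1))`** over every field of
characteristic `0` — the Boolean (no-spectator) case of the record's closed form `Σ C(k,s) N_d(σ,s) min (C(k−s,i), C(k−s,i+c))`. -/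
theorem rank_mulL_d3 (K : Type*) [Field K] [CharZero K] (k j : ℕ) :
    (Matrix.of fun (v : {v : Fin k → Fin 2 // (∑ i, (v i : ℕ)) + j = k * 1}) (m : {m : Fin k → Fin 2 // (∑ i, (m i : ℕ)) + (j + 1) = k * 1}) =>
      if List.ofFn (fun i => (v.1 i : ℕ)) ∈ colR 3 (List.ofFn (fun i => (m.1 i : ℕ))) then (1 : K) else 0).rank =
      min (k.choose j) (k.choose (j + 1)) := by
  rcases Nat.lt_or_ge (2 * j) k with h | h
  · have h1 := rank_mulL_d3_onto K k j h
    have h2 := Matrix.rank_le_card_width (Matrix.of fun (v : {v : Fin k → Fin 2 // (∑ i, (v i : ℕ)) + j = k * 1})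
      (m : {m : Fin k → Fin 2 // (∑ i, (m i : ℕ)) + (j + 1) = k * 1}) =>
        if List.ofFn (fun i => (v.1 i : ℕ)) ∈ colR 3 (List.ofFn (fun i => (m.1 i : ℕ))) then (1 : K) else 0)
    rw [h1, card_level, card_level] at h2
    rw [h1, card_level, Nat.min_eq_left h2]
  · have h1 := rank_mulL_d3_into K k j (by omega)
    have h2 := Matrix.rank_le_card_height (Matrix.of fun (v : {v : Fin k → Fin 2 // (∑ i, (v i : ℕ)) + j = k * 1})
      (m : {m : Fin k → Fin 2 // (∑ i, (m i : ℕ)) + (j + 1) = k * 1}) =>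
        if List.ofFn (fun i => (v.1 i : ℕ)) ∈ colR 3 (List.ofFn (fun i => (m.1 i : ℕ))) then (1 : K) else 0)
    rw [h1, card_level, card_level] at h2
    rw [h1, card_level, Nat.min_eq_right h2]

end Summit.HodgeConjecture.HodgeConjecture.HodgeLocus.Census.UnitColumnRankD3Levels
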